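import Mathlib.Analysis.Convex.Deriv
import Literature.Analysis.SpecialFunctions.CoffeyCsordas2013.Derivatives
import Literature.NumberTheory.LFunctions.DeBruijnPhiThetaTails
import HarnessLib

/-!
# The Pólya–de Bruijn kernel `Φ` is strictly log-concave on `ℝ` (Coffey–Csordas 2013, Theorem 2.4)

Topic `Literature/NumberTheory/LFunctions`; companion of `DeBruijnPhiThetaTails.lean` (heads and tails of the theta
series of `Φ`, `Φ′`, `Φ″` in the frequencies `y_n = π(n+1)²e^{4u}`), `DeBruijnPhiSecondDeriv.lean` and
`DeBruijnPhiDecreasing.lean` (Wintner: `Φ′ < 0` on `(0, ∞)`). For the tree's Rodgers–Tao-normalised kernel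
`Φ(u) = deBruijnPhi u = ∑_{n ≥ 1} (2π²n⁴e^{9u} − 3πn²e^{5u}) exp(−πn²e^{4u})` — term for term the "Jacobi theta
function" of Coffey–Csordas, Math. Comp. 82 (2013), (1.2) (`coffeyCsordas_Φ_eq_deBruijnPhi`: the tree's second copy
`Literature.Analysis.SpecialFunctions.CoffeyCsordas2013.Φ` IS `deBruijnPhi`) — we PROVE

* `deBruijnPhi_logConcave`: `0 < Φ′(u)² − Φ(u)Φ″(u)` for every real `u` — Coffey–Csordas 2013, THEOREM 2.4 (p. 2268,
  (2.17)): "The Jacobi theta function `Φ(t)` is (strictly) log-concave on `ℝ`. That is,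
  `S(t) = (Φ′(t))² − Φ(t)Φ″(t) > 0` for `t ∈ ℝ`"; the `deriv` form `deBruijnPhi_mul_deriv_deriv_lt`;
* QUANTITATIVE form (the content of the printed proof, `−(log a₁)″ = 16y + 96y/(2y − 3)²` by (2.8), made uniform):
  `deBruijnPhi_logConcave_quantitative`: `16πe^{4|u|}·Φ(u)² < Φ′(u)² − Φ(u)Φ″(u)` for EVERY real `u`, i.e.
  `deriv2_log_deBruijnPhi_lt`: `(log Φ)″(u) < −16πe^{4|u|} ≤ −16π`; hence `deriv2_log_deBruijnPhi_neg` and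
  `strictConcaveOn_log_deBruijnPhi` (`log Φ` strictly concave on `ℝ`); for the tilted potentials of the Jensen
  moment method this is `W_k″(u) = k/u² − (log Φ)″(u) > k/u² + 16πe^{4u}` on `(0, ∞)` with NO loss term;
* `coffeyCsordas_S_one_pos`: the same statement as `0 < CoffeyCsordas2013.S 1 t` in the notation (2.19) of the tree's
  Coffey–Csordas folder — where the ALL-`n` Conjecture 2.5 (`S_n > 0`, `n ≥ 1`) is REFUTED
  (`allDerivativesLogConcave_false`, `n = 9`); Theorem 2.4 is its (true, printed, here proved) case `n = 1`.

Use in the tree: `W_k = −k log u − log Φ(u)` has `W_k″ = k/u² − (log Φ)″ > 0` on `(0, ∞)`, the hypothesis under which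
the tree's one-dimensional Brascamp–Lieb inequality (`Literature.Probability.Distributions.brascampLieb_interval_Icc`)
applies to the tilted laws `ν_k ∝ u^k Φ(u) du` (Jensen-polynomial moment method, `XiMomentConcentration.lean`).

## Proof (the printed one, Coffey–Csordas §2, with the tail constants of `DeBruijnPhiThetaTails.lean`)

For `u ≥ 0` put `x = e^{4u} ≥ 1`, `y = πx ≥ π`, `v = e^{−y}`; by the toolbox `Φ = eᵘΣ₀`, `Φ′ = −eᵘΣ₁`, `Φ″ = eᵘΣ₂` with
`Σ_i = ∑_n P_i(y_n)e^{−y_n}`, so `S = e^{2u}(Σ₁² − Σ₀Σ₂)`. Split `Σ_i = A_i + T_i` (head `n = 0`, tail `n ≥ 1`):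
`Σ₁² − Σ₀Σ₂ = (A₁² − A₀A₂) + 2A₁T₁ + T₁² − A₀T₂ − A₂T₀ − T₀T₂ ≥ L − (2|A₁|T₁ + A₀T₂ + |A₂|T₀ + T₀T₂)` with
`L = 16y³(4y² − 12y + 15)v² ≥ 256·y³v²` (Coffey–Csordas Lemma 2.2 exactly; `4y² − 12y + 15 = (2y−3)² + 6 ≥ 16`), and by
the head/tail bounds each error term is `≤ c_i·y⁶v⁵ = c_i·y³v²·(yv)³` with `c = 2·4101 + 16401 + 1026 + 22 = 25 651`
(the last one using `v³ ≤ e^{−3π} < 1/12167`); since `yv = ye^{−y} ≤ πe^{−π}` and `(πe^{−π})³ < 0.00257`,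
`Σ₁² − Σ₀Σ₂ ≥ (256 − 25 651·0.00257)·y³v² > 190·y³v² > 0` — the printed "`S(t) > E(y)[256 − 56 424e^{−3y}y³] > 114E(y) > 0`"
with this file's constants; and since `L = 16y·A₀² + 96·y³v²` exactly (`A₀ = (2y² − 3y)v`; (2.8)), the same bookkeeping
with the two extra terms `32y·A₀T₀ ≤ 2051·y³v²·(yv)²v` and `16y·T₀² ≤ 16 417·y³v²·(yv)²v⁴` gives
`Σ₁² − Σ₀Σ₂ − 16y·Σ₀² ≥ (96 − 65.92 − 1.68 − 0.01)·y³v² > 0`, i.e. `S > 16πe^{4u}·Φ²` (`discr_pos_of_bounds`). The case `u < 0` follows from the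
evenness of `Φ`, `Φ″` and the oddness of `Φ′` (`deBruijnPhi_neg_holds`, `deBruijnPhiDeriv₂_neg_arg`, `deBruijnPhiDeriv_neg`).

## References

* M. W. Coffey, G. Csordas, *On the log-concavity of a Jacobi theta function*, Math. Comp. 82 (2013) 2265–2272,
  Theorem 2.4 (p. 2268), Proposition 2.1, Lemmas 2.2–2.3, (2.19). [CoffeyCsordas2013]
* G. Csordas, T. S. Norfolk, R. S. Varga, *The Riemann hypothesis and the Turán inequalities*, Trans. AMS 296
  (1986), Theorem A. [CsordasNorfolkVarga1986]
-/

noncomputable section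

open Filter Set
open scoped Real Topology

namespace Literature.NumberTheory.LFunctions

/-! ## 1. Two numerical facts: `ye^{−y} ≤ πe^{−π}` on `[π, ∞)` and `(πe^{−π})³ < 0.00257` -/

/-- `ye^{−y}` is decreasing from `π` on: `ye^{−y} ≤ πe^{−π}` for `y ≥ π`
(from `e^{y−π} ≥ 1 + (y − π)` and `π(1 + y − π) ≥ y`). [folklore] -/
private theorem mul_exp_neg_le_pi {y : ℝ} (hy : π ≤ y) : y * rexp (-y) ≤ π * rexp (-π) := by
  have hπ := Real.pi_gt_three
  have h1 : y ≤ π * rexp (y - π) := by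
    have h := Real.add_one_le_exp (y - π)
    nlinarith
  have h2 : rexp (y - π) * rexp (-(y - π)) = 1 := by rw [← Real.exp_add]; simp
  have h3 : rexp (-y) = rexp (-(y - π)) * rexp (-π) := by rw [← Real.exp_add]; congr 1; ring
  calc y * rexp (-y) = y * (rexp (-(y - π)) * rexp (-π)) := by rw [h3]
    _ ≤ (π * rexp (y - π)) * (rexp (-(y - π)) * rexp (-π)) := by gcongr
    _ = π * rexp (-π) * (rexp (y - π) * rexp (-(y - π))) := by ring
    _ = π * rexp (-π) := by rw [h2, mul_one]

/-- `(πe^{−π})³ < 0.00257` (`π < 3.15`, `e^{π} > 23`). [folklore] -/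
private theorem pi_mul_exp_neg_pi_cube_lt : (π * rexp (-π)) ^ 3 < 0.00257 := by
  have h1 : π * rexp (-π) < 3.15 * (1 / 23) :=
    mul_lt_mul'' Real.pi_lt_d2 wintner_exp_neg_pi_lt Real.pi_pos.le (Real.exp_pos _).le
  have h0 : 0 ≤ π * rexp (-π) := by positivity
  calc (π * rexp (-π)) ^ 3 < (3.15 * (1 / 23)) ^ 3 := by gcongr
    _ < 0.00257 := by norm_num

/-! ## 2. The main estimate for `u ≥ 0` and the theorem -/

/-- **The algebra of the proof of Coffey–Csordas Theorem 2.4** (with this file's constants, in a quantitative form):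
if the heads `A_i` and tails `T_i` of the three series obey the bounds of `DeBruijnPhiThetaTails.lean` at a point
`y ≥ π` with `0 < v ≤ e^{−π}` and `yv ≤ πe^{−π}` (true for `v = e^{−y}`), and the head of `Φ` is exactly
`A₀ = (2y² − 3y)v`, then `(A₀ + T₀)(A₂ + T₂) + 16y(A₀ + T₀)² < (A₁ + T₁)²`. Mechanism: `A₁² − A₀A₂ = 16y·A₀² + 96·y³v²`
(Coffey–Csordas (2.8): `L/a₁² = 16y + 96y/(2y − 3)²`), every other term is `≤ c·y³v²·(small)` with
`25 651·(yv)³ + 2051·y²v³ + 16 417·y²v⁶ < 68 < 96`. [cite: CoffeyCsordas2013, Theorem 2.4 (proof) and Lemma 2.2 (2.8)] -/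
theorem discr_pos_of_bounds {y v A₀ A₁ A₂ T₀ T₁ T₂ : ℝ} (hy : π ≤ y) (hv0 : 0 < v) (hvle : v ≤ rexp (-π))
    (hyv : y * v ≤ π * rexp (-π)) (hA₀ : A₀ = (2 * y ^ 2 - 3 * y) * v)
    (hL : A₁ ^ 2 - A₀ * A₂ = 16 * y ^ 3 * (4 * y ^ 2 - 12 * y + 15) * v ^ 2)
    (hA₁le : |A₁| ≤ 8 * y ^ 3 * v) (hA₂le : |A₂| ≤ 32 * y ^ 4 * v)
    (hT₀0 : 0 ≤ T₀) (hT₁0 : 0 ≤ T₁) (hT₂0 : 0 ≤ T₂)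
    (hT₀le : T₀ ≤ 2 * (1000 / 999 * 4 ^ 2 * (y ^ 2 * (v * v ^ 3))))
    (hT₁le : T₁ ≤ 8 * (1000 / 999 * 4 ^ 3 * (y ^ 3 * (v * v ^ 3))))
    (hT₂le : T₂ ≤ 32 * (1000 / 999 * 4 ^ 4 * (y ^ 4 * (v * v ^ 3)))) :
    (A₀ + T₀) * (A₂ + T₂) + 16 * y * (A₀ + T₀) ^ 2 < (A₁ + T₁) ^ 2 := by
  have hπ := Real.pi_gt_d2
  have hypos : 0 < y := lt_of_lt_of_le Real.pi_pos hy
  have hy0 : 0 ≤ y := hypos.le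
  have hq := coffeyCsordas_quadratic_ge hy
  -- numerics: `v ≤ 1/23`, `(yv)³ ≤ 0.00257`, `(yv)² ≤ 0.01876`
  have hv23 : v ≤ 1 / 23 := hvle.trans wintner_exp_neg_pi_lt.le
  have hyv0 : 0 ≤ y * v := mul_nonneg hy0 hv0.le
  have hw0 : 0 ≤ (y * v) ^ 3 := pow_nonneg hyv0 3
  have hwle : (y * v) ^ 3 ≤ 0.00257 :=
    (pow_le_pow_left₀ hyv0 hyv 3).trans pi_mul_exp_neg_pi_cube_lt.le
  have hw2le : (y * v) ^ 2 ≤ 0.01876 := by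
    have h1 : π * rexp (-π) < 3.15 * (1 / 23) :=
      mul_lt_mul'' Real.pi_lt_d2 wintner_exp_neg_pi_lt Real.pi_pos.le (Real.exp_pos _).le
    have h0 : 0 ≤ π * rexp (-π) := by positivity
    calc (y * v) ^ 2 ≤ (π * rexp (-π)) ^ 2 := pow_le_pow_left₀ hyv0 hyv 2
      _ ≤ (3.15 * (1 / 23)) ^ 2 := pow_le_pow_left₀ h0 h1.le 2
      _ ≤ 0.01876 := by norm_num
  -- `E = y³v² > 0`
  have hE0 : 0 < y ^ 3 * v ^ 2 := mul_pos (pow_pos hypos 3) (pow_pos hv0 2)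
  have hF0 : 0 ≤ y ^ 3 * v ^ 2 * (y * v) ^ 3 := mul_nonneg hE0.le hw0
  have hFle : y ^ 3 * v ^ 2 * (y * v) ^ 3 ≤ y ^ 3 * v ^ 2 * 0.00257 :=
    mul_le_mul_of_nonneg_left hwle hE0.le
  -- the head: `A₀ ≥ 0`, `A₀ ≤ 2y²v`, and the discriminant `L = 16y·A₀² + 96·E`
  have hA₀0 : 0 ≤ A₀ := by rw [hA₀]; exact mul_nonneg (by nlinarith) hv0.le
  have hA₀le : A₀ ≤ 2 * y ^ 2 * v := by
    rw [hA₀]; exact mul_le_mul_of_nonneg_right (by nlinarith) hv0.le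
  have hLeq : A₁ ^ 2 - A₀ * A₂ = 16 * y * A₀ ^ 2 + 96 * (y ^ 3 * v ^ 2) := by
    rw [hL, hA₀]; ring
  -- the four error terms of the discriminant, each `≤ c·F` (`y⁶·(v·v³)·v = F`)
  have hEw : y ^ 6 * (v * v ^ 3) * v = y ^ 3 * v ^ 2 * (y * v) ^ 3 := by ring
  have hy3v : 0 ≤ 8 * y ^ 3 * v := by positivity
  have hy2v : 0 ≤ 2 * y ^ 2 * v := by positivity
  have hy4v : 0 ≤ 32 * y ^ 4 * v := by positivity
  have herr1 : |A₁| * T₁ ≤ 4101 * (y ^ 3 * v ^ 2 * (y * v) ^ 3) := by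
    calc |A₁| * T₁ ≤ (8 * y ^ 3 * v) * (8 * (1000 / 999 * 4 ^ 3 * (y ^ 3 * (v * v ^ 3)))) :=
          mul_le_mul hA₁le hT₁le hT₁0 hy3v
      _ = (64 * (1000 / 999) * 64) * (y ^ 6 * (v * v ^ 3) * v) := by ring
      _ ≤ 4101 * (y ^ 3 * v ^ 2 * (y * v) ^ 3) := by
          rw [hEw]; exact mul_le_mul_of_nonneg_right (by norm_num) hF0
  have herr2 : A₀ * T₂ ≤ 16401 * (y ^ 3 * v ^ 2 * (y * v) ^ 3) := by
    calc A₀ * T₂ ≤ (2 * y ^ 2 * v) * (32 * (1000 / 999 * 4 ^ 4 * (y ^ 4 * (v * v ^ 3)))) :=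
          mul_le_mul hA₀le hT₂le hT₂0 hy2v
      _ = (64 * (1000 / 999) * 256) * (y ^ 6 * (v * v ^ 3) * v) := by ring
      _ ≤ 16401 * (y ^ 3 * v ^ 2 * (y * v) ^ 3) := by
          rw [hEw]; exact mul_le_mul_of_nonneg_right (by norm_num) hF0
  have herr3 : |A₂| * T₀ ≤ 1026 * (y ^ 3 * v ^ 2 * (y * v) ^ 3) := by
    calc |A₂| * T₀ ≤ (32 * y ^ 4 * v) * (2 * (1000 / 999 * 4 ^ 2 * (y ^ 2 * (v * v ^ 3)))) :=
          mul_le_mul hA₂le hT₀le hT₀0 hy4v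
      _ = (64 * (1000 / 999) * 16) * (y ^ 6 * (v * v ^ 3) * v) := by ring
      _ ≤ 1026 * (y ^ 3 * v ^ 2 * (y * v) ^ 3) := by
          rw [hEw]; exact mul_le_mul_of_nonneg_right (by norm_num) hF0
  have herr4 : T₀ * T₂ ≤ 22 * (y ^ 3 * v ^ 2 * (y * v) ^ 3) := by
    have hv3 : v ^ 3 ≤ 1 / 12167 := by
      calc v ^ 3 ≤ (1 / 23) ^ 3 := pow_le_pow_left₀ hv0.le hv23 3
        _ = 1 / 12167 := by norm_num
    have hc : (0 : ℝ) ≤ 64 * (1000 / 999) ^ 2 * 4096 * (y ^ 3 * v ^ 2 * (y * v) ^ 3) :=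
      mul_nonneg (by norm_num) hF0
    calc T₀ * T₂ ≤ (2 * (1000 / 999 * 4 ^ 2 * (y ^ 2 * (v * v ^ 3)))) *
          (32 * (1000 / 999 * 4 ^ 4 * (y ^ 4 * (v * v ^ 3)))) :=
          mul_le_mul hT₀le hT₂le hT₂0 (hT₀0.trans hT₀le)
      _ = (64 * (1000 / 999) ^ 2 * 4096) * (y ^ 6 * (v * v ^ 3) * v) * v ^ 3 := by ring
      _ ≤ (64 * (1000 / 999) ^ 2 * 4096) * (y ^ 3 * v ^ 2 * (y * v) ^ 3) * (1 / 12167) := by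
          rw [hEw]; exact mul_le_mul_of_nonneg_left hv3 hc
      _ = ((64 * (1000 / 999) ^ 2 * 4096) * (1 / 12167)) * (y ^ 3 * v ^ 2 * (y * v) ^ 3) := by ring
      _ ≤ 22 * (y ^ 3 * v ^ 2 * (y * v) ^ 3) := mul_le_mul_of_nonneg_right (by norm_num) hF0
  -- the two extra terms of `16y(A₀ + T₀)²`: `32y·A₀T₀ ≤ 2051·E·(yv)²v`, `16y·T₀² ≤ 16 417·E·(yv)²v⁴`
  have hG0 : 0 ≤ y ^ 3 * v ^ 2 * ((y * v) ^ 2 * v) := by positivity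
  have hGle : y ^ 3 * v ^ 2 * ((y * v) ^ 2 * v) ≤ y ^ 3 * v ^ 2 * (0.01876 * (1 / 23)) :=
    mul_le_mul_of_nonneg_left (mul_le_mul hw2le hv23 hv0.le (by norm_num)) hE0.le
  have herr5 : 32 * y * (A₀ * T₀) ≤ 2051 * (y ^ 3 * v ^ 2 * ((y * v) ^ 2 * v)) := by
    have h1 : A₀ * T₀ ≤ (2 * y ^ 2 * v) * (2 * (1000 / 999 * 4 ^ 2 * (y ^ 2 * (v * v ^ 3)))) :=
      mul_le_mul hA₀le hT₀le hT₀0 hy2v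
    calc 32 * y * (A₀ * T₀) ≤ 32 * y * ((2 * y ^ 2 * v) * (2 * (1000 / 999 * 4 ^ 2 * (y ^ 2 * (v * v ^ 3))))) :=
          mul_le_mul_of_nonneg_left h1 (by positivity)
      _ = (2048 * (1000 / 999)) * (y ^ 3 * v ^ 2 * ((y * v) ^ 2 * v)) := by ring
      _ ≤ 2051 * (y ^ 3 * v ^ 2 * ((y * v) ^ 2 * v)) := mul_le_mul_of_nonneg_right (by norm_num) hG0
  have hH0 : 0 ≤ y ^ 3 * v ^ 2 * ((y * v) ^ 2 * v ^ 4) := by positivity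
  have hHle : y ^ 3 * v ^ 2 * ((y * v) ^ 2 * v ^ 4) ≤ y ^ 3 * v ^ 2 * (0.01876 * (1 / 23) ^ 4) :=
    mul_le_mul_of_nonneg_left (mul_le_mul hw2le (pow_le_pow_left₀ hv0.le hv23 4) (by positivity)
      (by norm_num)) hE0.le
  have herr6 : 16 * y * T₀ ^ 2 ≤ 16417 * (y ^ 3 * v ^ 2 * ((y * v) ^ 2 * v ^ 4)) := by
    have h1 : T₀ ^ 2 ≤ (2 * (1000 / 999 * 4 ^ 2 * (y ^ 2 * (v * v ^ 3)))) ^ 2 :=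
      pow_le_pow_left₀ hT₀0 hT₀le 2
    calc 16 * y * T₀ ^ 2 ≤ 16 * y * (2 * (1000 / 999 * 4 ^ 2 * (y ^ 2 * (v * v ^ 3)))) ^ 2 :=
          mul_le_mul_of_nonneg_left h1 (by positivity)
      _ = (16384 * (1000 / 999) ^ 2) * (y ^ 3 * v ^ 2 * ((y * v) ^ 2 * v ^ 4)) := by ring
      _ ≤ 16417 * (y ^ 3 * v ^ 2 * ((y * v) ^ 2 * v ^ 4)) := mul_le_mul_of_nonneg_right (by norm_num) hH0
  -- signs
  have e1 : -(|A₁| * T₁) ≤ A₁ * T₁ := by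
    have := mul_le_mul_of_nonneg_right (neg_abs_le A₁) hT₁0
    rwa [neg_mul] at this
  have e3 : A₂ * T₀ ≤ |A₂| * T₀ := mul_le_mul_of_nonneg_right (le_abs_self A₂) hT₀0
  have hsq : 0 ≤ T₁ ^ 2 := sq_nonneg _
  have expand : (A₁ + T₁) ^ 2 - (A₀ + T₀) * (A₂ + T₂) - 16 * y * (A₀ + T₀) ^ 2 =
      (A₁ ^ 2 - A₀ * A₂) - 16 * y * A₀ ^ 2 + 2 * (A₁ * T₁) + T₁ ^ 2 - A₀ * T₂ - A₂ * T₀ - T₀ * T₂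
        - 32 * y * (A₀ * T₀) - 16 * y * T₀ ^ 2 := by ring
  -- name the nonlinear quantities so that the conclusion is a LINEAR consequence
  set p₁ := A₁ * T₁ with hp₁
  set p₂ := A₀ * T₂ with hp₂
  set p₃ := A₂ * T₀ with hp₃
  set p₄ := T₀ * T₂ with hp₄
  set p₅ := 32 * y * (A₀ * T₀) with hp₅
  set p₆ := 16 * y * T₀ ^ 2 with hp₆
  set p₇ := 16 * y * A₀ ^ 2 with hp₇
  set q₁ := |A₁| * T₁ with hq₁
  set q₃ := |A₂| * T₀ with hq₃
  set L := A₁ ^ 2 - A₀ * A₂ with hLdef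
  set F := y ^ 3 * v ^ 2 * (y * v) ^ 3 with hF
  set G := y ^ 3 * v ^ 2 * ((y * v) ^ 2 * v) with hG
  set H := y ^ 3 * v ^ 2 * ((y * v) ^ 2 * v ^ 4) with hH
  set E := y ^ 3 * v ^ 2 with hE
  set S := T₁ ^ 2 with hS
  set LHS := (A₀ + T₀) * (A₂ + T₂) with hLHS
  set Q := 16 * y * (A₀ + T₀) ^ 2 with hQ
  set RHS := (A₁ + T₁) ^ 2 with hRHS
  linarith [expand, hLeq, e1, herr1, herr2, e3, herr3, herr4, herr5, herr6, hsq, hFle, hGle, hHle, hE0]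

/-- **The core inequality** (Coffey–Csordas 2013, proof of Theorem 2.4, quantitative): for `x ≥ 1`, with
`Σ_i = ∑_n P_i(y_n)e^{−y_n}` the three one-series sums and `y = πx`, `Σ₀Σ₂ + 16y·Σ₀² < Σ₁²`.
[cite: CoffeyCsordas2013, Theorem 2.4 (proof)] -/
theorem tsum_phiPolyTerm_discr_pos {x : ℝ} (hx : 1 ≤ x) :
    (∑' n, phiPolyTerm (-3) 2 0 0 x n) * (∑' n, phiPolyTerm (-75) 330 (-224) 32 x n) +
        16 * (π * x) * (∑' n, phiPolyTerm (-3) 2 0 0 x n) ^ 2 <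
      (∑' n, phiPolyTerm 15 (-30) 8 0 x n) ^ 2 := by
  have hx0 : 0 < x := by linarith
  have hπ := Real.pi_gt_d2
  -- split off the heads
  rw [(summable_phiPolyTerm (-3) 2 0 0 hx0).tsum_eq_zero_add,
    (summable_phiPolyTerm (-75) 330 (-224) 32 hx0).tsum_eq_zero_add,
    (summable_phiPolyTerm 15 (-30) 8 0 hx0).tsum_eq_zero_add]
  have hy1 : π ≤ π * x := by nlinarith [Real.pi_pos]
  obtain ⟨hT₀0, hT₀le⟩ := tsum_phiPolyTerm_P0_succ_bounds hx
  obtain ⟨hT₁0, hT₁le⟩ := tsum_phiPolyTerm_P1_succ_bounds hx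
  obtain ⟨hT₂0, hT₂le⟩ := tsum_phiPolyTerm_P2_succ_bounds hx
  have h4 : rexp (-(4 * (π * x))) = rexp (-(π * x)) * rexp (-(π * x)) ^ 3 := by
    rw [← Real.exp_nat_mul, ← Real.exp_add]; congr 1; push_cast; ring
  rw [h4] at hT₀le hT₁le hT₂le
  have hA₀ : phiPolyTerm (-3) 2 0 0 x 0 = (2 * (π * x) ^ 2 - 3 * (π * x)) * rexp (-(π * x)) := by
    simp only [phiPolyTerm, thetaFreq]; push_cast; ring
  exact discr_pos_of_bounds hy1 (Real.exp_pos _) (Real.exp_le_exp.2 (by linarith)) (mul_exp_neg_le_pi hy1) hA₀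
    (phiPolyTerm_head_discr x) (abs_phiPolyTerm_zero_P1_le hx) (abs_phiPolyTerm_zero_P2_le hx)
    hT₀0 hT₁0 hT₂0 hT₀le hT₁le hT₂le

/-- **`Φ·Φ″ + 16πe^{4u}·Φ² < Φ′²` for `u ≥ 0`** (the quantitative content of the proof of Theorem 2.4:
`−(log Φ)″(u) > 16πe^{4u} = ` the leading term of `−(log a₁)″`, cf. (2.8)). [cite: CoffeyCsordas2013, Theorem 2.4 (proof)] -/
theorem deBruijnPhi_mul_deriv₂_lt_of_nonneg {u : ℝ} (hu : 0 ≤ u) :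
    deBruijnPhi u * deBruijnPhiDeriv₂ u + 16 * π * rexp (4 * u) * deBruijnPhi u ^ 2 < deBruijnPhiDeriv u ^ 2 := by
  have hx1 : 1 ≤ rexp (4 * u) := Real.one_le_exp (by linarith)
  rw [deBruijnPhi_eq_tsum, deBruijnPhiDeriv₂_eq_tsum, deBruijnPhiDeriv_eq_tsum]
  have h := tsum_phiPolyTerm_discr_pos hx1
  have he : 0 < rexp u ^ 2 := by positivity
  have := mul_lt_mul_of_pos_left h he
  nlinarith

/-- **Quantitative log-concavity for all real `u`**: `16πe^{4|u|}·Φ(u)² < Φ′(u)² − Φ(u)Φ″(u)`, i.e.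
`−(log Φ)″(u) > 16πe^{4|u|} (≥ 16π)`; from the case `u ≥ 0` by the evenness of `Φ`, `Φ″` and the oddness of `Φ′`.
[cite: CoffeyCsordas2013, Theorem 2.4 (proof)] -/
theorem deBruijnPhi_logConcave_quantitative (u : ℝ) :
    16 * π * rexp (4 * |u|) * deBruijnPhi u ^ 2 < deBruijnPhiDeriv u ^ 2 - deBruijnPhi u * deBruijnPhiDeriv₂ u := by
  rcases le_or_gt 0 u with hu | hu
  · rw [abs_of_nonneg hu]; linarith [deBruijnPhi_mul_deriv₂_lt_of_nonneg hu]
  · have h := deBruijnPhi_mul_deriv₂_lt_of_nonneg (u := -u) (by linarith)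
    have e0 : deBruijnPhi (-u) = deBruijnPhi u := deBruijnPhi_neg_holds u
    rw [e0, deBruijnPhiDeriv₂_neg_arg, deBruijnPhiDeriv_neg, neg_sq] at h
    rw [abs_of_neg hu, show 4 * -u = 4 * (-u) by ring]
    linarith

/-- **Coffey–Csordas 2013, Theorem 2.4 (log-concavity of the Jacobi theta function / Pólya–de Bruijn
kernel).** "The Jacobi theta function `Φ(t)` is (strictly) log-concave on `ℝ`. That is,
`S(t) = (Φ′(t))² − Φ(t)Φ″(t) > 0` for `t ∈ ℝ`" — here for the tree's `Φ = deBruijnPhi` (the same function,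
Rodgers–Tao normalisation) with `Φ′ = deBruijnPhiDeriv`, `Φ″ = deBruijnPhiDeriv₂`.
[cite: CoffeyCsordas2013, Theorem 2.4] -/
theorem deBruijnPhi_logConcave (u : ℝ) :
    0 < deBruijnPhiDeriv u ^ 2 - deBruijnPhi u * deBruijnPhiDeriv₂ u :=
  lt_of_le_of_lt (by positivity) (deBruijnPhi_logConcave_quantitative u)

/-- The same in `deriv` form: `Φ(u)·Φ″(u) < (Φ′(u))²` with Mathlib's `deriv`. [cite: CoffeyCsordas2013, Theorem 2.4] -/
theorem deBruijnPhi_mul_deriv_deriv_lt (u : ℝ) :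
    deBruijnPhi u * deriv (deriv deBruijnPhi) u < deriv deBruijnPhi u ^ 2 := by
  have hd : deriv deBruijnPhi = deBruijnPhiDeriv := funext fun x => (hasDerivAt_deBruijnPhi x).deriv
  rw [hd, deriv_deBruijnPhiDeriv]
  linarith [deBruijnPhi_logConcave u]

/-! ## 3. `log Φ` is strictly concave -/

/-- The derivative of `log Φ`: `(log Φ)′ = Φ′/Φ`. [cite: CoffeyCsordas2013, §1 (p. 2265: log-concave iff (f′)² − ff″ ≥ 0)] -/
theorem hasDerivAt_log_deBruijnPhi (u : ℝ) :
    HasDerivAt (fun t => Real.log (deBruijnPhi t)) (deBruijnPhiDeriv u / deBruijnPhi u) u :=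
  (hasDerivAt_deBruijnPhi u).log (deBruijnPhi_pos_holds u).ne'

/-- The derivative of `Φ′/Φ`: `(Φ′/Φ)′ = (Φ″Φ − Φ′Φ′)/Φ²`. [cite: CoffeyCsordas2013, §1 (p. 2265: log-concave iff (f′)² − ff″ ≥ 0)] -/
theorem hasDerivAt_deriv_log_deBruijnPhi (u : ℝ) :
    HasDerivAt (fun t => deBruijnPhiDeriv t / deBruijnPhi t)
      ((deBruijnPhiDeriv₂ u * deBruijnPhi u - deBruijnPhiDeriv u * deBruijnPhiDeriv u) / deBruijnPhi u ^ 2) u :=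
  (hasDerivAt_deBruijnPhiDeriv u).div (hasDerivAt_deBruijnPhi u) (deBruijnPhi_pos_holds u).ne'

/-- `deriv (log Φ) = Φ′/Φ`. [cite: CoffeyCsordas2013, §1 (p. 2265: log-concave iff (f′)² − ff″ ≥ 0)] -/
theorem deriv_log_deBruijnPhi :
    deriv (fun t => Real.log (deBruijnPhi t)) = fun u => deBruijnPhiDeriv u / deBruijnPhi u :=
  funext fun u => (hasDerivAt_log_deBruijnPhi u).deriv

/-- **`(log Φ)″(u) < 0` for every real `u`.** [cite: CoffeyCsordas2013, Theorem 2.4] -/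
theorem deriv2_log_deBruijnPhi_neg (u : ℝ) :
    deriv (deriv (fun t => Real.log (deBruijnPhi t))) u < 0 := by
  rw [deriv_log_deBruijnPhi, (hasDerivAt_deriv_log_deBruijnPhi u).deriv]
  apply div_neg_of_neg_of_pos _ (pow_pos (deBruijnPhi_pos_holds u) 2)
  linarith [deBruijnPhi_logConcave u]

/-- **Quantitative form: `(log Φ)″(u) < −16πe^{4|u|}` for every real `u`.** [cite: CoffeyCsordas2013, Theorem 2.4 (proof)] -/
theorem deriv2_log_deBruijnPhi_lt (u : ℝ) :
    deriv (deriv (fun t => Real.log (deBruijnPhi t))) u < -(16 * π * rexp (4 * |u|)) := by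
  rw [deriv_log_deBruijnPhi, (hasDerivAt_deriv_log_deBruijnPhi u).deriv,
    div_lt_iff₀ (pow_pos (deBruijnPhi_pos_holds u) 2)]
  linarith [deBruijnPhi_logConcave_quantitative u]

/-- **`log Φ` is strictly concave on `ℝ`** (Coffey–Csordas 2013, Theorem 2.4, in Mathlib's `StrictConcaveOn`
form). [cite: CoffeyCsordas2013, Theorem 2.4] -/
theorem strictConcaveOn_log_deBruijnPhi :
    StrictConcaveOn ℝ univ (fun t => Real.log (deBruijnPhi t)) := by
  refine strictConcaveOn_of_deriv2_neg convex_univ ?_ fun x _ => ?_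
  · exact (continuous_deBruijnPhi.log fun t => (deBruijnPhi_pos_holds t).ne').continuousOn
  · exact deriv2_log_deBruijnPhi_neg x


/-! ## 4. In the vocabulary of the tree's Coffey–Csordas (2013) folder: Theorem 2.4 is `S₁ > 0` (true),
while Conjecture 2.5 (`S_n > 0` for all `n ≥ 1`) is refuted there (`allDerivativesLogConcave_false`, `n = 9`) -/

/-- The tree's two copies of the Jacobi theta function agree: `CoffeyCsordas2013.Φ = deBruijnPhi`
(both are (1.2) of Coffey–Csordas = Rodgers–Tao eq. (2), term for term). [cite: CoffeyCsordas2013, (1.2)] -/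
theorem coffeyCsordas_Φ_eq_deBruijnPhi :
    Literature.Analysis.SpecialFunctions.CoffeyCsordas2013.Φ = deBruijnPhi := by
  funext t
  unfold Literature.Analysis.SpecialFunctions.CoffeyCsordas2013.Φ deBruijnPhi
  refine tsum_congr fun n => ?_
  simp only [Literature.Analysis.SpecialFunctions.CoffeyCsordas2013.a, deBruijnPhiSummand]
  push_cast
  ring

/-- **Coffey–Csordas 2013, Theorem 2.4 in the notation (2.19) of their Conjecture 2.5**: `S₁(t) > 0` for every
real `t`, where `S_n(t) = (Φ⁽ⁿ⁾(t))² − Φ⁽ⁿ⁻¹⁾(t)Φ⁽ⁿ⁺¹⁾(t)` is the tree's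
`Literature.Analysis.SpecialFunctions.CoffeyCsordas2013.S`. (The case `n = 1` is the printed THEOREM 2.4; the
all-`n` statement 2.5 is a conjecture of the paper, REFUTED in the tree at `n = 9`, `t = 0` by
`Literature.Analysis.SpecialFunctions.CoffeyCsordas2013.allDerivativesLogConcave_false` — the two must not be
conflated.) [cite: CoffeyCsordas2013, Theorem 2.4 and (2.19)] -/
theorem coffeyCsordas_S_one_pos (t : ℝ) : 0 < Literature.Analysis.SpecialFunctions.CoffeyCsordas2013.S 1 t := by
  have hd : deriv deBruijnPhi = deBruijnPhiDeriv := funext fun x => (hasDerivAt_deBruijnPhi x).deriv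
  simp only [Literature.Analysis.SpecialFunctions.CoffeyCsordas2013.S, coffeyCsordas_Φ_eq_deBruijnPhi,
    iteratedDeriv_succ, iteratedDeriv_zero, Nat.sub_self, hd, deriv_deBruijnPhiDeriv]
  exact deBruijnPhi_logConcave t

end Literature.NumberTheory.LFunctions

end
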